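import Literature.IUT.HodgeTheaters.PiAvatarNegCompatGenuine
import Literature.IUT.HodgeTheaters.PiAvatarGlobalCuspLabels

/-!
# [IUTchI] Ex 6.3 (ii), negative case, at the GENUINE initial Θ-data (good places) — the LABEL half: the global automorphism
# of the `[−1]`-square fixes the zero cusp and acts as `x ↦ −x` in the chart based at `ε⁰` (proof-only; β-engine (I2)(ii))

S. Mochizuki, *Inter-universal Teichmüller theory I*, kurims manuscript (May 2020), Example 6.3 (i) p. 160–161 (the fixed chart
`LabCusp^±(𝒟^{⊚±}) ⥲ 𝔽_l`; "`φ^{Θell}_±` is equivariant", NEGATIVE case), Def 6.1 (iii) p. 156–157 (zero label, `Aut ↠ {±1}`),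
(v) p. 158 (`Aut_±(𝒟^{⊚±})`, the `𝔽_l^±`-torsor of cusps determined by `ε̲`) ([IUTchI] Ex 6.3 (ii) p.161) [claim: Mochizuki2012,
status: disputed] (D-0012 claim key, series status DISPUTED; nothing of the series is asserted; no side is taken on [IUTchIII]
Cor. 3.12).

β-ENGINE, last input (abc-iut-L5-t13; reductions p420660 `negCompatModel_iff_commutes`, p423891 `negCompatModel_of_fixes` /
`mem_lifts_iff_gChart₀`): over abc-iut-L5-t4's binding slots (p423760 `phiEllAt`, p425994 `toFlStarGlobal`, `PiAvatarGlobalCuspLabels`: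
`gLabAutOfPiCund` = the label action (K2), `gChart₀Model` = the chart based at `ε⁰` (K1)) and my p428568 (`exists_negCompat_good_mem`),
this PROOF-ONLY file records **`InitialThetaData.exists_negCompat_good_labels`**: conditional only on abc-iut-L5-t1's typed §1 claims
`hA`, for every decomposition group `Gv` (good `v̲`) ONE element `c ∈ Π_{C̲_K} ∖ Π_{X̲_K}` gives the square
`a ≫ φ^{Θell}_{•,v̲} = φ^{Θell}_{•,v̲} ≫ b` ON THE NOSE (`a = (xΠ_v̲ ↦ xcΠ_v̲)`, `b = (xΠ_{X̲_K} ↦ xcΠ_{X̲_K})`), `toFlStarGlobal b = 1`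
(`b ∈ Aut_±(𝒟^{⊚±})`), and on the labels `GLab 𝒟^{⊚±} = Cusp(X̲_K)`: `b` FIXES the zero-cusp class `gChart₀⁻¹ 0 = ε⁰`, acts as `x ↦ −x`
in the chart `gChart₀` — hence MOVES a class (`l ≥ 5`) — i.e. `b` is a lift of `(0, −1) ∈ 𝔽_l^{⋊±}` in the sense of `Ex63.lifts`
read through (K1)/(K2).  This is, literally, the hypothesis list of `Ex63.negCompatModel_of_fixes` (and of `mem_lifts_iff_gChart₀`)
at the bound objects of every good place: the law (β) — hence (α) and the §6 rows Prop 6.5 (i) s.2 / 6.6 (ii)(iii) / 6.8 (i) — holds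
at the genuine kit as soon as the `PMBaseKit` record is assembled from these slots (kit packaging; the bad places need the datum of
GAP G-L5t4g3-2 (iii), SHAPE OF RECORD of abc-iut-L5-lead RULINGS #36 (4)).  Nothing is claimed about the kit record itself.

Proof-only (no definitions); typed ≠ proved elsewhere.
-/

namespace Literature.IUT.HodgeTheaters

open CategoryTheory

universe u v w

section Labels

variable {F : Type u} {K : Type v} {Fbar : Type w} [Field F] [NumberField F] [Field K]
  [NumberField K] [Algebra F K] [Field Fbar] [Algebra F Fbar] [Algebra K Fbar]
  {E : WeierstrassCurve F} [E.IsElliptic] {l : ℕ} {P : BadPlacePredicates K}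
  (D : InitialThetaData F K Fbar E l P) (CG : D.geom.pe.CuspGalois)

namespace InitialThetaData

/-- The zero-cusp class of the chart based at `ε⁰` is `ε⁰` ((K1): `gChart₀ ε⁰ = 0`). ([IUTchI] Def 6.1 (v) p.158)
[claim: Mochizuki2012, status: disputed] -/
theorem gChart₀Model_symm_zero [Fact l.Prime] : (D.gChart₀Model CG).symm 0 = D.geom.pe.ε0 := by
  rw [Equiv.symm_apply_eq]
  exact (D.gChart₀Model_ε0 CG).symm

/-- For `c ∈ Π_{C̲_K} ∖ Π_{X̲_K}` the label action is NOT the identity (it reads `x ↦ −x` in the chart and `l ≥ 5`): the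
`±`-involution MOVES a cusp of `X̲_K` ([IUTchI] Def 6.1 (v) p.158: `ι̲` switches `ε′, ε″`). ([IUTchI] Def 6.1 (v) p.158)
[claim: Mochizuki2012, status: disputed] -/
theorem gLabAutOfPiCund_ne_one_of_not_mem_PiXund [Fact l.Prime] (c : D.PiC) (hc : c ∈ D.PiCund)
    (hcX : c ∉ D.PiXund) : D.gLabAutOfPiCund CG c hc ≠ 1 := by
  intro h
  have key := D.gChart₀Model_gLabAut_of_not_mem_PiXund CG c hc hcX ((D.gChart₀Model CG).symm 1)
  rw [h, Equiv.Perm.one_apply, Equiv.apply_symm_apply] at key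
  haveI : Fact (2 < l) := ⟨by have := D.five_le_l; omega⟩
  exact ZMod.neg_one_ne_one key.symm

/-- **Ex 6.3 (ii), negative case, at every good place of the genuine data — ALL inputs of the law (β), labels included**
([IUTchI] Ex 6.3 (ii) p.161; conditional only on the typed §1 claims `hA`). For every decomposition group `Gv` there is
`c ∈ Π_{C̲_K} ∖ Π_{X̲_K}` normalising `Π_v̲` and `Π_{X̲_K}` such that, with `a = (xΠ_v̲ ↦ xcΠ_v̲)` and `b = (xΠ_{X̲_K} ↦ xcΠ_{X̲_K})`:
(square) `a ≫ φ^{Θell}_{•,v̲} = φ^{Θell}_{•,v̲} ≫ b`; ((I2)(i)) `toFlStarGlobal b = 1`; ((I2)(ii)) the label action of `b` FIXES the class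
`gChart₀⁻¹ 0` (the zero cusp `ε⁰`), reads `x ↦ −x` in the chart `gChart₀` (so `b` is a lift of `(0,−1)`), and is `≠ 1`.
([IUTchI] Ex 6.3 (ii) p.161) [claim: Mochizuki2012, status: disputed] -/
theorem exists_negCompat_good_labels [Fact l.Prime] [(D.PiXund.subgroupOf D.PiXK).Normal]
    (hA : D.geom.pe.ArrowCoveringClaims) (Gv : Subgroup (Fbar ≃ₐ[F] Fbar)) :
    ∃ (c : D.PiC) (hc : c ∈ D.PiCund), c ∉ D.PiXund ∧
      ∃ (hcv : c ∈ Subgroup.normalizer ((D.PiXarrow ⊓ Gv.comap D.augGF : Subgroup D.PiC) : Set D.PiC))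
        (hcK : c ∈ Subgroup.normalizer ((D.PiXund : Subgroup D.PiC) : Set D.PiC)),
      (OrbitCat.autOfNormalizer c hcv).hom ≫ D.phiEllAt Gv = D.phiEllAt Gv ≫ (OrbitCat.autOfNormalizer c hcK).hom ∧
      D.toFlStarGlobal (OrbitCat.autOfNormalizer c hcK) = 1 ∧
      D.gLabAutOfPiCund CG c hc ((D.gChart₀Model CG).symm 0) = (D.gChart₀Model CG).symm 0 ∧
      (∀ x, D.gChart₀Model CG (D.gLabAutOfPiCund CG c hc x) = -D.gChart₀Model CG x) ∧
      D.gLabAutOfPiCund CG c hc ≠ 1 := by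
  obtain ⟨c, hcCund, hcU, hcv, hcK, hsq, hfl⟩ := D.exists_negCompat_good_mem hA Gv
  refine ⟨c, hcCund, hcU, hcv, hcK, hsq, hfl, ?_,
    fun x => D.gChart₀Model_gLabAut_of_not_mem_PiXund CG c hcCund hcU x,
    D.gLabAutOfPiCund_ne_one_of_not_mem_PiXund CG c hcCund hcU⟩
  rw [D.gChart₀Model_symm_zero CG]
  exact D.gLabAutOfPiCund_ε0 CG c hcCund

/-- The label action of `b` IS the `(0,−1)` permutation in the chart — the exact right-hand side of `Ex63.lifts K (FlPM.mk 0 (−1))`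
read through (K1)/(K2): `gLabAut = gChart₀ ≫ (FlPM.toPerm (0,−1)) ≫ gChart₀⁻¹`. ([IUTchI] Ex 6.3 (i) p.161)
[claim: Mochizuki2012, status: disputed] -/
theorem gLabAutOfPiCund_eq_chart_conj_negOne [Fact l.Prime] (c : D.PiC) (hc : c ∈ D.PiCund) (hcX : c ∉ D.PiXund) :
    (D.gLabAutOfPiCund CG c hc : D.geom.pe.Cusp ≃ D.geom.pe.Cusp) =
      (D.gChart₀Model CG).trans ((FlPM.toPerm l (FlPM.mk 0 (-1))).trans (D.gChart₀Model CG).symm) := by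
  ext x
  apply (D.gChart₀Model CG).injective
  rw [D.gChart₀Model_gLabAut_of_not_mem_PiXund CG c hc hcX x, Equiv.trans_apply, Equiv.trans_apply,
    Equiv.apply_symm_apply, FlPM.toPerm_apply, FlPM.mk_smul, Units.neg_smul, one_smul, add_zero]

end InitialThetaData

end Labels

end Literature.IUT.HodgeTheaters
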